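import Mathlib
import HarnessLib
import Literature.Probability.Process.PointStationaryLaw
import Summits.AtomisticToContinuum.Crystallization.Theses.PalmUnimodularRigidity

/-!
# Route PalmUnimodularRigidity — the glue `PalmToHinge`

We prove the support item `PalmToHinge` (stmt-AtomisticToContinuum-9231) of route
`PalmUnimodularRigidity`:

  `PalmRigidity → BenjaminiSchrammLimit → CrysEnergyLimit → GroundStatesChargePeriodic`.

Proof (as planned in the route file): given a sequence of LJ ground states, the
Benjamini–Schramm limit `P` supplied by `BenjaminiSchrammLimit` has
`E_P[h] = lim E(φ j)/φ j = e*` by `CrysEnergyLimit` and uniqueness of limits, hence is minimising;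
`PalmRigidity` makes `P`-a.e. configuration a rotated relaxed HCP crystal
`count|A(hcpStacking a h)` with `(a, h)` in the compact box `[1/2, 2]²`.  A compactness /
finite-subcover argument produces a point `(a₀, h₀)` of the box every neighbourhood of which is
charged by the parameter law (no measurability is needed: outer measures are finitely
subadditive; uses `Literature.Probability.Process.count_restrict_singleton_ne_zero_iff` to read
the atoms of `count|S`).  We take `Q := hcpPeriodicConfiguration a₀ h₀`, base point `q := 0`.  Since
`barlowPos a h s k i j` is linear in `(a, h)` index by index, HCP crystals with parameters
`η`-close to `(a₀, h₀)` are `(2ηR)`-close to `hcpStacking a₀ h₀` inside every ball of radius `R`;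
the density-transfer clause of `BenjaminiSchrammLimit` applied to the set `T` of such crystals
(`P T > 0`) with radius `R + ε`, tolerance `ε/2` and density `ρ := P(T)/2` then yields, eventually
along `φ`, hence frequently in `N`, at least `ρ N` particles whose `R`-neighbourhood is `ε`-matched
both ways with `x_i + A(Q.points - 0)`.
-/

namespace Summit.AtomisticToContinuum.Crystallization.Theorems.PalmUnimodularRigidity

open scoped Topology ENNReal
open Filter Set MeasureTheory Literature.MathematicalPhysics.StatisticalMechanics

/-! ## Helper 1: a support point of a law concentrated near a compact parameter set -/

/-- **Support point of a compactly parametrised almost-sure event.**  If `P`-almost every `ω`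
admits a parameter `z` in the compact set `K` with `p ω z`, and `P ≠ 0`, then some `z₀ ∈ K` has
every neighbourhood `U` charged: `P {ω | ∃ z ∈ U, p ω z} ≠ 0`.  (Finite subcover + finite
subadditivity of the outer measure; no measurability hypotheses.) -/
theorem exists_mem_forall_nhds_measure_ne_zero {Ω X : Type*} [MeasurableSpace Ω]
    [TopologicalSpace X] (P : Measure Ω) [NeZero P] {K : Set X} (hK : IsCompact K)
    (p : Ω → X → Prop) (hae : ∀ᵐ ω ∂P, ∃ z ∈ K, p ω z) :
    ∃ z₀ ∈ K, ∀ U ∈ 𝓝 z₀, P {ω | ∃ z ∈ U, p ω z} ≠ 0 := by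
  by_contra hcon
  push Not at hcon
  choose! U hU hPU using hcon
  obtain ⟨t, htK, hKt⟩ := hK.elim_nhds_subcover U hU
  have h1 : ∀ z₀ ∈ t, ∀ᵐ ω ∂P, ω ∉ {ω | ∃ z ∈ U z₀, p ω z} := fun z₀ hz₀ =>
    measure_eq_zero_iff_ae_notMem.1 (hPU z₀ (htK z₀ hz₀))
  have h2 : ∀ᵐ ω ∂P, ∀ z₀ ∈ t, ω ∉ {ω | ∃ z ∈ U z₀, p ω z} :=
    (Filter.eventually_all_finset t).2 h1
  have h3 : ∀ᵐ _ω ∂P, False := by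
    filter_upwards [hae, h2] with ω ⟨z, hzK, hpz⟩ hω
    have hz : z ∈ ⋃ z₀ ∈ t, U z₀ := hKt hzK
    simp only [Set.mem_iUnion] at hz
    obtain ⟨z₀, hz₀t, hzU⟩ := hz
    exact hω z₀ hz₀t ⟨z, hzU, hpz⟩
  rw [Filter.eventually_false_iff_eq_bot, ae_eq_bot] at h3
  exact NeZero.ne P h3

/-! ## Helper 2: Lipschitz dependence of the Barlow lattice points on the parameters `(a, h)` -/

/-- **Index-by-index closeness of relaxed stackings.**  For parameters `a, h ≥ 1/2` and
`|a' - a|, |h' - h| ≤ η`, the point with the same indices `(k, i, j)` of the stacking with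
parameters `(a', h')` is within `2 η ‖barlowPos a h s k i j‖` of `barlowPos a h s k i j`
(each coordinate of `barlowPos` is linear in `a` resp. `h`). -/
theorem dist_barlowPos_barlowPos_le {a h a' h' η : ℝ} (s : ℤ → ℤ) (k i j : ℤ)
    (ha : 1 / 2 ≤ a) (hh : 1 / 2 ≤ h) (hη : 0 ≤ η) (ha' : |a' - a| ≤ η) (hh' : |h' - h| ≤ η) :
    dist (barlowPos a' h' s k i j) (barlowPos a h s k i j) ≤
      2 * η * ‖barlowPos a h s k i j‖ := by
  rw [EuclideanSpace.dist_eq, EuclideanSpace.norm_eq]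
  have h2η : (0 : ℝ) ≤ 2 * η := by positivity
  rw [show 2 * η * √(∑ l, ‖barlowPos a h s k i j l‖ ^ 2) =
      √((2 * η) ^ 2 * ∑ l, ‖barlowPos a h s k i j l‖ ^ 2) by
    rw [Real.sqrt_mul (sq_nonneg _), Real.sqrt_sq h2η]]
  apply Real.sqrt_le_sqrt
  simp only [Fin.sum_univ_three, Real.norm_eq_abs, sq_abs, Real.dist_eq, barlowPos_apply_zero,
    barlowPos_apply_one, barlowPos_apply_two]
  have hda : (a' - a) ^ 2 ≤ (2 * η) ^ 2 * a ^ 2 := by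
    have h1 : (a' - a) ^ 2 ≤ η ^ 2 := by
      rw [← sq_abs]; exact pow_le_pow_left₀ (abs_nonneg _) ha' 2
    have h4a : (1 : ℝ) ≤ 4 * a ^ 2 := by nlinarith
    calc (a' - a) ^ 2 ≤ η ^ 2 := h1
      _ = η ^ 2 * 1 := by ring
      _ ≤ η ^ 2 * (4 * a ^ 2) := mul_le_mul_of_nonneg_left h4a (sq_nonneg η)
      _ = (2 * η) ^ 2 * a ^ 2 := by ring
  have hdh : (h' - h) ^ 2 ≤ (2 * η) ^ 2 * h ^ 2 := by
    have h1 : (h' - h) ^ 2 ≤ η ^ 2 := by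
      rw [← sq_abs]; exact pow_le_pow_left₀ (abs_nonneg _) hh' 2
    have h4h : (1 : ℝ) ≤ 4 * h ^ 2 := by nlinarith
    calc (h' - h) ^ 2 ≤ η ^ 2 := h1
      _ = η ^ 2 * 1 := by ring
      _ ≤ η ^ 2 * (4 * h ^ 2) := mul_le_mul_of_nonneg_left h4h (sq_nonneg η)
      _ = (2 * η) ^ 2 * h ^ 2 := by ring
  set c₀ : ℝ := (i : ℝ) + j / 2 + haggLabel s k / 2
  set c₁ : ℝ := (j : ℝ) + haggLabel s k / 3
  have e0 : (a' * c₀ - a * c₀) ^ 2 = (a' - a) ^ 2 * c₀ ^ 2 := by ring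
  have e1 : (a' * √3 / 2 * c₁ - a * √3 / 2 * c₁) ^ 2 = (a' - a) ^ 2 * (√3 / 2 * c₁) ^ 2 := by ring
  have e2 : ((k : ℝ) * h' - k * h) ^ 2 = (h' - h) ^ 2 * (k : ℝ) ^ 2 := by ring
  rw [e0, e1, e2]
  have f0 : (a * c₀) ^ 2 = a ^ 2 * c₀ ^ 2 := by ring
  have f1 : (a * √3 / 2 * c₁) ^ 2 = a ^ 2 * (√3 / 2 * c₁) ^ 2 := by ring
  have f2 : ((k : ℝ) * h) ^ 2 = h ^ 2 * (k : ℝ) ^ 2 := by ring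
  rw [f0, f1, f2]
  have g0 := mul_le_mul_of_nonneg_right hda (sq_nonneg c₀)
  have g1 := mul_le_mul_of_nonneg_right hda (sq_nonneg (√3 / 2 * c₁))
  have g2 := mul_le_mul_of_nonneg_right hdh (sq_nonneg (k : ℝ))
  nlinarith [g0, g1, g2]

/-- The origin is the point `(0, 0, 0)` of every Barlow stacking. -/
theorem barlowPos_zero_zero_zero (a h : ℝ) (s : ℤ → ℤ) : barlowPos a h s 0 0 0 = 0 := by
  simp [barlowPos]

/-- `0 ∈ hcpStacking a h`. -/
theorem zero_mem_hcpStacking (a h : ℝ) : (0 : EuclideanSpace ℝ (Fin 3)) ∈ hcpStacking a h :=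
  ⟨0, 0, 0, (barlowPos_zero_zero_zero a h _).symm⟩

/-! ## Helper 3: the deterministic matching step -/

/-- **From a matched nearby crystal to a matched reference crystal.**  If the recentred
configuration around particle `i` is `(R + ε, ε/2)`-matched both ways with the rotated crystal
`A '' hcpStacking a h`, whose parameters are `η`-close to `(a₀, h₀)` with `4 η (R + ε) ≤ ε`, then
it is `(R, ε)`-matched both ways with `x i + A (hcpStacking a₀ h₀)` in the sense of
`GroundStatesChargePeriodic` (base point `0`). -/
theorem matched_hcp_of_matched_near {a₀ h₀ a h η R ε : ℝ} (ha₀ : 1 / 2 ≤ a₀) (hh₀ : 1 / 2 ≤ h₀)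
    (ha : 1 / 2 ≤ a) (hh : 1 / 2 ≤ h) (hη : 0 ≤ η) (haa : |a - a₀| ≤ η) (hhh : |h - h₀| ≤ η)
    (hε : 0 ≤ ε) (hηRε : 4 * η * (R + ε) ≤ ε)
    (A : EuclideanSpace ℝ (Fin 3) ≃ₗᵢ[ℝ] EuclideanSpace ℝ (Fin 3)) {N : ℕ}
    (x : Fin N → EuclideanSpace ℝ (Fin 3)) (i : Fin N)
    (h1 : ∀ p : EuclideanSpace ℝ (Fin 3), p ∈ A '' hcpStacking a h → ‖p‖ ≤ R + ε →
      ∃ q ∈ Set.range (fun k : Fin N => x k - x i), dist q p ≤ ε / 2)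
    (h2 : ∀ q ∈ Set.range (fun k : Fin N => x k - x i), ‖q‖ ≤ R + ε →
      ∃ p : EuclideanSpace ℝ (Fin 3), p ∈ A '' hcpStacking a h ∧ dist q p ≤ ε / 2) :
    (∀ s ∈ hcpStacking a₀ h₀, dist s 0 ≤ R →
        ∃ j : Fin N, dist (x j) (x i + A.toLinearIsometry (s - 0)) ≤ ε) ∧
      (∀ j : Fin N, dist (x j) (x i) ≤ R →
        ∃ s ∈ hcpStacking a₀ h₀, dist (x j) (x i + A.toLinearIsometry (s - 0)) ≤ ε) := by
  have hkey : ∀ (j : Fin N) (s : EuclideanSpace ℝ (Fin 3)),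
      dist (x j) (x i + A.toLinearIsometry (s - 0)) = dist (x j - x i) (A s) := by
    intro j s
    rw [sub_zero, LinearIsometryEquiv.coe_toLinearIsometry, dist_eq_norm, dist_eq_norm,
      sub_add_eq_sub_sub]
  constructor
  · rintro s ⟨k, m, n, rfl⟩ hsR
    rw [dist_zero_right] at hsR
    set s' : EuclideanSpace ℝ (Fin 3) := barlowPos a h alternatingHagg k m n with hs'
    have hd : dist s' (barlowPos a₀ h₀ alternatingHagg k m n) ≤ 2 * η * R := by
      have haa' : |a - a₀| ≤ η := haa
      calc dist s' (barlowPos a₀ h₀ alternatingHagg k m n)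
          ≤ 2 * η * ‖barlowPos a₀ h₀ alternatingHagg k m n‖ :=
            dist_barlowPos_barlowPos_le alternatingHagg k m n ha₀ hh₀ hη haa hhh
        _ ≤ 2 * η * R := mul_le_mul_of_nonneg_left hsR (by positivity)
    have hmem : A s' ∈ A '' hcpStacking a h := ⟨s', ⟨k, m, n, rfl⟩, rfl⟩
    have hnorm : ‖A s'‖ ≤ R + ε := by
      rw [LinearIsometryEquiv.norm_map]
      calc ‖s'‖ = dist s' 0 := (dist_zero_right _).symm
        _ ≤ dist s' (barlowPos a₀ h₀ alternatingHagg k m n) +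
              dist (barlowPos a₀ h₀ alternatingHagg k m n) 0 := dist_triangle _ _ _
        _ ≤ 2 * η * R + R := by rw [dist_zero_right]; exact add_le_add hd hsR
        _ ≤ R + ε := by nlinarith
    obtain ⟨q, ⟨j, rfl⟩, hq⟩ := h1 (A s') hmem hnorm
    refine ⟨j, ?_⟩
    rw [hkey]
    calc dist (x j - x i) (A (barlowPos a₀ h₀ alternatingHagg k m n))
        ≤ dist (x j - x i) (A s') + dist (A s') (A (barlowPos a₀ h₀ alternatingHagg k m n)) :=
          dist_triangle _ _ _
      _ ≤ ε / 2 + 2 * η * R := by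
          rw [LinearIsometryEquiv.dist_map]; exact add_le_add hq hd
      _ ≤ ε := by nlinarith
  · intro j hj
    have hq : x j - x i ∈ Set.range (fun k : Fin N => x k - x i) := ⟨j, rfl⟩
    have hqn : ‖x j - x i‖ ≤ R + ε := by rw [← dist_eq_norm]; linarith
    obtain ⟨p, ⟨s', ⟨k, m, n, rfl⟩, rfl⟩, hd⟩ := h2 _ hq hqn
    refine ⟨barlowPos a₀ h₀ alternatingHagg k m n, ⟨k, m, n, rfl⟩, ?_⟩
    rw [hkey]
    have hjn : ‖x j - x i‖ ≤ R := by rwa [← dist_eq_norm]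
    have hn' : ‖barlowPos a h alternatingHagg k m n‖ ≤ R + ε := by
      calc ‖barlowPos a h alternatingHagg k m n‖ = ‖A (barlowPos a h alternatingHagg k m n)‖ := by
            rw [LinearIsometryEquiv.norm_map]
        _ = dist 0 (A (barlowPos a h alternatingHagg k m n)) := (dist_zero_left _).symm
        _ ≤ dist (0 : EuclideanSpace ℝ (Fin 3)) (x j - x i) +
              dist (x j - x i) (A (barlowPos a h alternatingHagg k m n)) := dist_triangle _ _ _
        _ ≤ R + ε / 2 := by rw [dist_zero_left]; exact add_le_add hjn hd
        _ ≤ R + ε := by linarith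
    have haa' : |a₀ - a| ≤ η := by rw [abs_sub_comm]; exact haa
    have hhh' : |h₀ - h| ≤ η := by rw [abs_sub_comm]; exact hhh
    have hd2 : dist (barlowPos a h alternatingHagg k m n) (barlowPos a₀ h₀ alternatingHagg k m n) ≤
        2 * η * (R + ε) := by
      rw [dist_comm]
      calc dist (barlowPos a₀ h₀ alternatingHagg k m n) (barlowPos a h alternatingHagg k m n)
          ≤ 2 * η * ‖barlowPos a h alternatingHagg k m n‖ :=
            dist_barlowPos_barlowPos_le alternatingHagg k m n ha hh hη haa' hhh'
        _ ≤ 2 * η * (R + ε) := mul_le_mul_of_nonneg_left hn' (by positivity)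
    calc dist (x j - x i) (A (barlowPos a₀ h₀ alternatingHagg k m n))
        ≤ dist (x j - x i) (A (barlowPos a h alternatingHagg k m n)) +
            dist (A (barlowPos a h alternatingHagg k m n))
              (A (barlowPos a₀ h₀ alternatingHagg k m n)) := dist_triangle _ _ _
      _ ≤ ε / 2 + 2 * η * (R + ε) := by
          rw [LinearIsometryEquiv.dist_map]; exact add_le_add hd hd2
      _ ≤ ε := by nlinarith

/-! ## The item -/

/-- **Item stmt-AtomisticToContinuum-9231 (`PalmToHinge`).**  The Palm-side rigidity of minimising
point-stationary hard-core laws, the Benjamini–Schramm limit construction and the energy limit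
`E(N)/N → e*` together give the shared finite-`N` hinge `GroundStatesChargePeriodic`: one periodic
configuration (a relaxed HCP crystal with parameters in the support of the limit law) is charged
with positive density at every scale, frequently in `N`. -/
theorem palmToHinge_proof :
    Summit.AtomisticToContinuum.Crystallization.Theses.PalmUnimodularRigidity.PalmToHinge := by
  intro hPalm hBS hLim x hx
  obtain ⟨φ, hφ, δ, hδ, P, hP, hcore, hstat, hE, htr⟩ := hBS x hx
  have hlim' : Tendsto (fun j : ℕ => groundStateEnergy lennardJones 3 (φ j) / (φ j : ℝ)) atTop
      (𝓝 (⨅ Q : PeriodicConfiguration 3, Q.energyPerParticle lennardJones)) :=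
    hLim.comp hφ.tendsto_atTop
  have hEq := tendsto_nhds_unique hE hlim'
  have hae := hPalm δ hδ P hP hcore hstat hEq.le
  -- the parameter box and the parametrised event
  set K : Set (ℝ × ℝ) := Icc (1 / 2 : ℝ) 2 ×ˢ Icc (1 / 2 : ℝ) 2 with hKdef
  have hK : IsCompact K := isCompact_Icc.prod isCompact_Icc
  set p : Measure (EuclideanSpace ℝ (Fin 3)) → ℝ × ℝ → Prop := fun μ z =>
    (1 / 2 ≤ z.1 ∧ z.1 ≤ 2 ∧ 1 / 2 ≤ z.2 ∧ z.2 ≤ 2) ∧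
      ∃ A : EuclideanSpace ℝ (Fin 3) ≃ₗᵢ[ℝ] EuclideanSpace ℝ (Fin 3),
        μ = (Measure.count : Measure (EuclideanSpace ℝ (Fin 3))).restrict
          (A '' hcpStacking z.1 z.2)
    with hpdef
  have hae' : ∀ᵐ μ ∂P, ∃ z ∈ K, p μ z := by
    filter_upwards [hae] with μ hμ
    obtain ⟨a, h, _, _, h1, h2, h3, h4, A, -, hμ⟩ := hμ
    exact ⟨(a, h), ⟨⟨h1, h2⟩, ⟨h3, h4⟩⟩, ⟨h1, h2, h3, h4⟩, A, hμ⟩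
  haveI : NeZero P := ⟨IsProbabilityMeasure.ne_zero P⟩
  obtain ⟨⟨a₀, h₀⟩, hzK, hsupp⟩ := exists_mem_forall_nhds_measure_ne_zero P hK p hae'
  obtain ⟨⟨ha₀, ha₀'⟩, ⟨hh₀, hh₀'⟩⟩ := hzK
  have ha₀0 : a₀ ≠ 0 := by intro h0; rw [h0] at ha₀; norm_num at ha₀
  have hh₀0 : h₀ ≠ 0 := by intro h0; rw [h0] at hh₀; norm_num at hh₀
  refine ⟨hcpPeriodicConfiguration ha₀0 hh₀0, ?_⟩
  intro R ε hR hε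
  -- tolerances
  set η : ℝ := ε / (4 * (R + ε)) with hηdef
  have hRε : 0 < R + ε := by positivity
  have hηpos : 0 < η := by positivity
  have hηRε : 4 * η * (R + ε) ≤ ε := by
    rw [hηdef]; field_simp; exact le_rfl
  -- the charged set of nearby crystals
  set T : Set (Measure (EuclideanSpace ℝ (Fin 3))) :=
    {μ | ∃ z ∈ Metric.ball ((a₀, h₀) : ℝ × ℝ) η, p μ z} with hTdef
  have hT : P T ≠ 0 := hsupp _ (Metric.ball_mem_nhds _ hηpos)
  have hTreal : 0 < (P T).toReal := ENNReal.toReal_pos hT (measure_ne_top P T)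
  refine ⟨(P T).toReal / 2, half_pos hTreal, ?_⟩
  have hev := htr T (R + ε) (ε / 2) (half_pos hε) ((P T).toReal / 2) (half_lt_self hTreal)
  -- the property transferred to `N = φ j`
  set good : (N : ℕ) → Fin N → Prop := fun N i =>
    ∃ A : EuclideanSpace ℝ (Fin 3) →ₗᵢ[ℝ] EuclideanSpace ℝ (Fin 3),
      ∃ q ∈ (hcpPeriodicConfiguration ha₀0 hh₀0).points,
      (∀ s ∈ (hcpPeriodicConfiguration ha₀0 hh₀0).points, dist s q ≤ R →
        ∃ j : Fin N, dist (x N j) (x N i + A (s - q)) ≤ ε) ∧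
      (∀ j : Fin N, dist (x N j) (x N i) ≤ R →
        ∃ s ∈ (hcpPeriodicConfiguration ha₀0 hh₀0).points, dist (x N j) (x N i + A (s - q)) ≤ ε)
    with hgood
  have himp : ∀ (N : ℕ) (i : Fin N),
      (∃ ν ∈ T, ((∀ p : EuclideanSpace ℝ (Fin 3), ν {p} ≠ 0 → ‖p‖ ≤ R + ε →
          ∃ q ∈ (Set.range (fun k : Fin N => x N k - x N i)), dist q p ≤ ε / 2) ∧
        (∀ q ∈ (Set.range (fun k : Fin N => x N k - x N i)), ‖q‖ ≤ R + ε →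
          ∃ p : EuclideanSpace ℝ (Fin 3), ν {p} ≠ 0 ∧ dist q p ≤ ε / 2))) → good N i := by
    rintro N i ⟨ν, ⟨⟨a, h⟩, hz, ⟨ha, ha', hh, hh'⟩, A, rfl⟩, h1, h2⟩
    rw [Metric.mem_ball, Prod.dist_eq, max_lt_iff, Real.dist_eq, Real.dist_eq] at hz
    have h1' : ∀ p : EuclideanSpace ℝ (Fin 3), p ∈ A '' hcpStacking a h → ‖p‖ ≤ R + ε →
        ∃ q ∈ Set.range (fun k : Fin N => x N k - x N i), dist q p ≤ ε / 2 := fun p hp =>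
      h1 p ((Literature.Probability.Process.count_restrict_singleton_ne_zero_iff _ p).2 hp)
    have h2' : ∀ q ∈ Set.range (fun k : Fin N => x N k - x N i), ‖q‖ ≤ R + ε →
        ∃ p : EuclideanSpace ℝ (Fin 3), p ∈ A '' hcpStacking a h ∧ dist q p ≤ ε / 2 :=
      fun q hq hqn => (h2 q hq hqn).imp fun p hp =>
        ⟨(Literature.Probability.Process.count_restrict_singleton_ne_zero_iff _ p).1 hp.1, hp.2⟩
    obtain ⟨c1, c2⟩ := matched_hcp_of_matched_near ha₀ hh₀ ha hh hηpos.le hz.1.le hz.2.le hε.le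
      hηRε A (x N) i h1' h2'
    refine ⟨A.toLinearIsometry, 0, ?_, ?_, ?_⟩
    · rw [hcpPeriodicConfiguration_points]; exact zero_mem_hcpStacking a₀ h₀
    · rw [hcpPeriodicConfiguration_points]; exact c1
    · rw [hcpPeriodicConfiguration_points]; exact c2
  have hev' : ∀ᶠ j : ℕ in atTop,
      (P T).toReal / 2 * ((φ j : ℕ) : ℝ) ≤ (Nat.card {i : Fin (φ j) // good (φ j) i} : ℝ) := by
    filter_upwards [hev] with j hj
    refine hj.trans ?_
    exact_mod_cast Nat.card_le_card_of_injective _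
      (Subtype.map_injective (fun i hi => himp (φ j) i hi) Function.injective_id)
  exact hφ.tendsto_atTop.frequently
    (p := fun N : ℕ => (P T).toReal / 2 * (N : ℝ) ≤ (Nat.card {i : Fin N // good N i} : ℝ))
    hev'.frequently

end Summit.AtomisticToContinuum.Crystallization.Theorems.PalmUnimodularRigidity
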